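import Summits.CriticalPhenomena.CardyFormulaZ2.Theorems.CardyAnchoredRigiditySubseqCardyJointLimitCluster

/-!
# Dilation rigidity of a unique limit / a unique cluster point of the bond-`ℤ²` crossing probabilities
# (crux `SubseqCardy`, stmt-CriticalPhenomena-5768, line `registered`, lead c4)

Route `CardyAnchoredRigidity` (decl shared with `CardyLocalRigidity`), sub-problem `CardyFormulaZ2`.
Part 2 of the structure theory of joint sequential limits
(`CardyAnchoredRigiditySubseqCardyJointLimitSymmetry`) proved DILATION INTERTWINING
(`JointLimit.tendsto_dilate`): if `g` is the joint limit of the crossing probabilities along the mesh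
sequence `u n → 0⁺`, then `R ↦ g (c·R)` is the joint limit along `u n / c`. So the FAMILY of joint
sequential limits — equivalently (part 4, `clusterPt_iff_jointLimit`) the cluster set
`Λ' = {g | MapClusterPt g (𝓝[>] 0) (fun δ R ↦ bondDomainCrossingProb R δ)}` of the crossing-function
path (`ClusterPt.map_dilate_mem`) — is dilation invariant, while dilation covariance of ONE limit,
`g (c·R) = g R`, is the open heart of stub S2 `stub_limitConformal` (item stmt-8266).

This file records the two rigidity corollaries of the intertwining:

* `limit_dilationInvariant_of_tendsto` — (a) if the FULL limit `δ → 0⁺` of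
  `bondDomainCrossingProb R δ` exists for every conformal rectangle `R`, then it is dilation invariant.
  Relevant to route `CardyUniqueLimit`: existence of the limit alone already gives scale invariance,
  hence — with the translation / `D₄` invariance of part 2 and the DKKMO rotation invariance of part 3 —
  full similarity invariance of the limit; what stays open on that route is the Möbius / inversion
  step (barrier `ScaleCovarianceNotMoebius`).
* `clusterPt_dilationInvariant_of_subsingleton` — (b) the cluster-set form: if `Λ'` has at most one
  point, its point is dilation invariant.

Both are one-line consequences of `JointLimit.tendsto_dilate`, `JointLimit.tendsto_div_const`,
`ClusterPt.map_dilate_mem` and uniqueness of limits in `ℝ`.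

References: O. Schramm, S. Smirnov, Ann. Probab. 39 (2011) §1.3, §5 (scaling limits of crossing
probabilities along subsequences); G. Grimmett, *Percolation* (1999) §1.6.
-/

noncomputable section

namespace Summit.CriticalPhenomena.CardyFormulaZ2.Cruxes.SubseqCardy.Birth

open Set Filter Topology
open Literature.Probability.RandomPlanarGeometry (ConformalRectangle)
open Literature.Probability.Percolation (bondDomainCrossingProb)

namespace JointLimit

/-- A full limit `δ → 0⁺` is in particular the joint sequential limit along the mesh sequence
`1 / (n+1)`, and along it the dilated functional `R ↦ g (c·R)` has the same limit as `g`. [folklore] -/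
theorem map_dilate_of_tendsto {g : ConformalRectangle → ℝ}
    (hg : ∀ R : ConformalRectangle,
      Tendsto (fun δ : ℝ => bondDomainCrossingProb R δ) (𝓝[>] (0 : ℝ)) (𝓝 (g R)))
    (R : ConformalRectangle) {c : ℝ} (hc : 0 < c) (T : ℂ ≃ₜ ℂ) (hT : ∀ z : ℂ, T z = (c : ℂ) * z) :
    g (R.map T) = g R := by
  -- the mesh sequence `u n = 1/(n+1) → 0⁺`, along which the joint limit is `g`
  have hu : Tendsto (fun n : ℕ => 1 / ((id n : ℝ) + 1)) atTop (𝓝[>] (0 : ℝ)) :=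
    tendsto_one_div_strictMono_add_one_nhdsWithin_Ioi strictMono_id
  have hgu : ∀ R' : ConformalRectangle,
      Tendsto (fun n : ℕ => bondDomainCrossingProb R' (1 / ((id n : ℝ) + 1))) atTop (𝓝 (g R')) :=
    fun R' => (hg R').comp hu
  -- along `u n / c` the crossing probabilities of `R` tend both to `g (c·R)` (intertwining) and to
  -- `g R` (full limit along a sequence tending to `0⁺`)
  have h₁ : Tendsto (fun n : ℕ => bondDomainCrossingProb R (1 / ((id n : ℝ) + 1) / c)) atTop
      (𝓝 (g (R.map T))) := tendsto_dilate hgu hc T hT R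
  have h₂ : Tendsto (fun n : ℕ => bondDomainCrossingProb R (1 / ((id n : ℝ) + 1) / c)) atTop
      (𝓝 (g R)) := (hg R).comp (tendsto_div_const hu hc)
  exact tendsto_nhds_unique h₁ h₂

end JointLimit

namespace ClusterPt

/-- If the cluster set `Λ'` of the crossing-function path has at most one point, then its point is
dilation invariant (`Λ'` is dilation invariant, `ClusterPt.map_dilate_mem`). [folklore] -/
theorem map_dilate_of_subsingleton
    (huniq : ∀ g g' : ConformalRectangle → ℝ,
      MapClusterPt g (𝓝[>] (0 : ℝ)) (fun (δ : ℝ) (R : ConformalRectangle) => bondDomainCrossingProb R δ) →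
      MapClusterPt g' (𝓝[>] (0 : ℝ)) (fun (δ : ℝ) (R : ConformalRectangle) => bondDomainCrossingProb R δ) →
      g = g')
    {g : ConformalRectangle → ℝ}
    (hg : MapClusterPt g (𝓝[>] (0 : ℝ)) (fun (δ : ℝ) (R : ConformalRectangle) => bondDomainCrossingProb R δ))
    (R : ConformalRectangle) {c : ℝ} (hc : 0 < c) (T : ℂ ≃ₜ ℂ) (hT : ∀ z : ℂ, T z = (c : ℂ) * z) :
    g (R.map T) = g R :=
  congrFun (huniq (fun R' => g (R'.map T)) g (map_dilate_mem hg hc T hT) hg) R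

end ClusterPt

/-- **Registered sub-goal `limit_dilationInvariant_of_tendsto` (line `registered`, lead c4) — a full
limit is dilation invariant**: if for every conformal rectangle `R` the bond-`ℤ²` crossing probability
`bondDomainCrossingProb R δ` converges as `δ → 0⁺`, to `g R`, then `g (c·R) = g R` for every `c > 0`
(here `T` is the dilation `z ↦ c z` as a plane homeomorphism). Existence of the scaling limit alone
forces scale invariance. [folklore] -/
theorem limit_dilationInvariant_of_tendsto : ∀ g : Literature.Probability.RandomPlanarGeometry.ConformalRectangle → ℝ, (∀ R : Literature.Probability.RandomPlanarGeometry.ConformalRectangle, Filter.Tendsto (fun δ : ℝ => Literature.Probability.Percolation.bondDomainCrossingProb R δ) (nhdsWithin (0 : ℝ) (Set.Ioi 0)) (nhds (g R))) → ∀ (R : Literature.Probability.RandomPlanarGeometry.ConformalRectangle) (c : ℝ), 0 < c → ∀ T : ℂ ≃ₜ ℂ, (∀ z : ℂ, T z = (c : ℂ) * z) → g (R.map T) = g R :=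
  fun _ hg R _ hc T hT => JointLimit.map_dilate_of_tendsto hg R hc T hT

/-- **Registered sub-goal `clusterPt_dilationInvariant_of_subsingleton` (line `registered`, lead c4) —
a unique cluster point is dilation invariant**: if the cluster set, as `δ → 0⁺`, of the
crossing-function path `δ ↦ (R ↦ bondDomainCrossingProb R δ)` in the product space
`ConformalRectangle → ℝ` has at most one point, then every cluster point `g` satisfies
`g (c·R) = g R` for every `c > 0`. [folklore] -/
theorem clusterPt_dilationInvariant_of_subsingleton : (∀ g g' : Literature.Probability.RandomPlanarGeometry.ConformalRectangle → ℝ, MapClusterPt g (nhdsWithin (0 : ℝ) (Set.Ioi 0)) (fun (δ : ℝ) (R : Literature.Probability.RandomPlanarGeometry.ConformalRectangle) => Literature.Probability.Percolation.bondDomainCrossingProb R δ) → MapClusterPt g' (nhdsWithin (0 : ℝ) (Set.Ioi 0)) (fun (δ : ℝ) (R : Literature.Probability.RandomPlanarGeometry.ConformalRectangle) => Literature.Probability.Percolation.bondDomainCrossingProb R δ) → g = g') → ∀ g : Literature.Probability.RandomPlanarGeometry.ConformalRectangle → ℝ, MapClusterPt g (nhdsWithin (0 : ℝ) (Set.Ioi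 0)) (fun (δ : ℝ) (R : Literature.Probability.RandomPlanarGeometry.ConformalRectangle) => Literature.Probability.Percolation.bondDomainCrossingProb R δ) → ∀ (R : Literature.Probability.RandomPlanarGeometry.ConformalRectangle) (c : ℝ), 0 < c → ∀ T : ℂ ≃ₜ ℂ, (∀ z : ℂ, T z = (c : ℂ) * z) → g (R.map T) = g R :=
  fun huniq _ hg R _ hc T hT => ClusterPt.map_dilate_of_subsingleton huniq hg R hc T hT

end Summit.CriticalPhenomena.CardyFormulaZ2.Cruxes.SubseqCardy.Birth

end
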